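import Literature.NumberTheory.Transcendental.ZilberField
import Literature.NumberTheory.Transcendental.EclClosureOperatorProofs
import Literature.ModelTheory.Quasiminimal.LocalIsoSystems
import HarnessLib

/-!
# Quasiminimality of Zilber fields: reduction to the uniqueness of `ecl`-closures over a generic

Sibling file of `Literature/NumberTheory/Transcendental/ZilberField.lean` for the named fact
`Literature.NumberTheory.Transcendental.IsZilberField.isQuasiminimal` (B. Zilber, *Pseudo-exponentiation on algebraically closed
fields of characteristic zero*, Ann. Pure Appl. Logic 132 (2005), Thm 1.2; complete proof:
M. Bays, J. Kirby, Algebra & Number Theory 12 (2018), Thm 9.1 = Thm 1.2): **every Zilber field is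
quasiminimal** — every subset definable with parameters in `⟨K; +, ·, exp⟩` is countable or
co-countable.

## The printed proof and the decomposition

Zilber's method (Zilber 2005 §5; J. Kirby, *On quasiminimal excellent classes*, J. Symbolic
Logic 75 (2010) — "OQMEC" below; Bays–Hart–Hyttinen–Kesälä–Kirby 2014; Bays–Kirby 2013 and 2018):
the class of Zilber fields with the pregeometry `ecl` satisfies axioms I–II of quasiminimal
excellent classes (Bays–Kirby 2013, Props 4–5; for Kirby's `ecl` = Zilber's closure by Kirby 2010
(*Exponential algebraicity*), Thms 1.1–1.3), whence (OQMEC Thm 2.1) isomorphisms between countable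
closed subsets extend across generic elements and through closures, and (OQMEC Lemma 5.1)
every model is quasiminimal: a definable set `S = φ(K, b)` either contains or misses all points
outside the countable closed set `ecl(b)`, because any two such points are matched by a member of
a back-and-forth system of isomorphisms between closures of finite sets fixing `b`, and such
members preserve first-order formulas (Karp). Only the last two steps are formalised here; the
extension theorem is vendored as ONE named fact, to be proved in later sessions
(it is the core of Zilber's categoricity theorem below `ℵ₁`):

* `Literature.NumberTheory.Transcendental.IsZilberField.eclIso_extension` — NAMED FACT (OQMEC Thm 2.1 for Zilber fields): for
  finite tuples `b, b'`, an E-field isomorphism `g : ecl(b) ≅ ecl(b')` and `a ∉ ecl(b)`,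
  `a' ∉ ecl(b')`, the map `g ∪ {(a, a')}` extends to an E-field isomorphism
  `ecl(b, a) ≅ ecl(b', a')`.

Everything else is **proved**:

* `Literature.NumberTheory.Transcendental.Khovanskii.IsSol.map`, `….image_ecl_subset`, `….image_ecl_equiv` — functoriality of
  Kirby's `ecl` (Khovanskii systems) under E-field embeddings/isomorphisms;
  `Literature.NumberTheory.Transcendental.Khovanskii.eclSubfield.instExponentialRing`, `….eclSubfield.image_ecl` — `ecl C` is an
  E-field in which `ecl` agrees with `ecl` in `K` (OQMEC Lemma 1.3 for Zilber fields).
* `Literature.IsEIsoOn g A B` — "`g : K → K` restricts to an E-field isomorphism `A ≅ B`", with `id`,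
  `symm`, `restrict`, `equiv` (bundled `ExponentialRingEquiv` of the E-subfields) and
  `image_ecl` (`g(ecl T) = ecl(g T)` for `T ⊆ ecl S`).
* `Literature.EclIsoRel K n x y` — the tuples `x, y` are matched by an E-field isomorphism
  `ecl(x) ≅ ecl(y)`; `symm`, `comp`, `apply_eq`, `funMap_eq`, `relMap`, `snoc_of_mem`.
* `Literature.NumberTheory.Transcendental.isLocalIsoSystem_eclIsoRel` — for an uncountable Zilber field, granted the named fact,
  `EclIsoRel K` is a back-and-forth system of local isomorphisms
  (`FirstOrder.Language.IsLocalIsoSystem`, file `Literature/ModelTheory/Quasiminimal/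
  LocalIsoSystems.lean`); `Literature.NumberTheory.Transcendental.eclIsoRel_snoc_of_notMem` — uniqueness of the generic type over a
  finite tuple (OQMEC Lemma 5.1, first part).
* `Literature.IsZilberField.isQuasiminimal_of_eclIso_extension :
  IsZilberField.eclIso_extension → IsZilberField.isQuasiminimal` — the assembly (countable `K`
  trivially; uncountable `K` by `IsLocalIsoSystem.countable_or_countable_compl` with the
  countable sets `ecl(b)`, countable by the countable closure property).

## Faithfulness notes

* The named fact is OQMEC Thm 2.1 with `G = ecl(b)` (countable by CCP, closed), `H = ecl(G a)`,
  `B = {a}`, `f₀ = g`, `ψ_B = {(a, a')}`, in the class of Zilber fields (axioms I, II: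
  Bays–Kirby 2013 Props 4–5, Zilber 2005 §5); its conclusion there is an isomorphism of
  `L`-structures for the expanded language `L` of Bays–Kirby 2013 §2.4, in particular of
  exponential fields, which is all that is recorded. `IsZilberField` (tree) is Bays–Kirby's
  `ECF_{SK,CCP}`: the tree's SEAC implies Kirby's scheme (`ZilberField.lean`), and the tree's CCP
  for Kirby's `ecl` is Zilber's CCP by Kirby 2010 (EAEF) Thms 1.1–1.3.
* No expanded language is introduced: the Karp argument of `LocalIsoSystems.lean` runs in
  `Language.expRing` itself, unnesting terms along forth-steps, so the conclusion is literally
  `Language.expRing.IsQuasiminimal K`.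
* Status of the named fact. A proof of `IsZilberField.eclIso_extension` in print goes through
  `ℵ₀`-saturation of Zilber fields for finitely generated exponentially-algebraic strong
  extensions (Bays–Kirby 2018 Lemma 8.3 / Prop. 11.2), Kummer genericity (thumbtack lemma,
  Bays–Zilber 2011 Thm 3, used twice: Bays–Kirby 2013, proof of Prop. 5, closed case) and the
  back-and-forth of OQMEC Thm 2.1 over the countable closed set `ecl(b)`. Quasiminimality itself
  needs less (Bays–Kirby 2013, proof of Prop. 5: "`ℵ₀`-homogeneity over `∅`", i.e. over finitely
  generated strong subspaces, where strong exponential-algebraic closedness applies directly);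
  that shorter route, through Γ-isomorphisms of strong hulls (`GammaFields.lean`,
  `ZilberSaturation.lean`) instead of isomorphisms of `ecl`-closures, is pursued in a sibling
  file, and either route discharges `IsZilberField.isQuasiminimal`.

## References

* B. Zilber, *Pseudo-exponentiation on algebraically closed fields of characteristic zero*,
  Ann. Pure Appl. Logic 132 (2005) 67–95: Thm 1.2, §5.
* J. Kirby, *On quasiminimal excellent classes*, J. Symbolic Logic 75 (2010) 551–564,
  arXiv:0707.4496: Def. 1.1–1.2, Lemma 1.3, Thm 2.1, Lemma 5.1.
* M. Bays, J. Kirby, *Excellence and uncountable categoricity of Zilber's exponential fields*,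
  arXiv:1305.0493 (2013): §2.4, Lemma 3, Props 4–5, Cor. 6.
* M. Bays, B. Hart, T. Hyttinen, M. Kesälä, J. Kirby, *Quasiminimal structures and excellence*,
  Bull. LMS 46 (2014) 155–163: Lemma 2.2, Thm 2.3, Prop. 7.1.
* M. Bays, J. Kirby, *Pseudo-exponential maps, variants, and quasiminimality*, Algebra & Number
  Theory 12 (2018) 493–549: Thm 1.2, Lemma 8.3, Thm 9.1.
* J. Kirby, *Exponential algebraicity in exponential fields*, Bull. LMS 42 (2010) 879–890:
  Def. 3.1–3.2, Lemma 3.3, Thms 1.1–1.3.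
-/

noncomputable section

open Set MvPolynomial FirstOrder

namespace Literature.NumberTheory.Transcendental

/-! ### Functoriality of `ecl` under morphisms of exponential fields -/

namespace Khovanskii

section Functorial

variable {R S : Type*} [Field R] [Field S] [Literature.ModelTheory.ExponentialFields.ExponentialRing R] [Literature.ModelTheory.ExponentialFields.ExponentialRing S]

/-- The point `(x̄, e^{x̄})` is mapped to the point `(φ x̄, e^{φ x̄})` by an E-ring morphism.
[folklore] -/
theorem kpt_comp_eHom (φ : Literature.ModelTheory.ExponentialFields.ExponentialRingHom R S) {ι : Type*} (x : ι → R) :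
    φ ∘ kpt x = kpt (φ ∘ x) := by
  funext s
  rcases s with i | i
  · rfl
  · simp [kpt]

/-- Evaluation at `(x̄, e^{x̄})` commutes with an E-ring morphism (coefficients mapped by `φ`).
[folklore] -/
theorem eval_kpt_map (φ : Literature.ModelTheory.ExponentialFields.ExponentialRingHom R S) {ι : Type*} (x : ι → R)
    (p : MvPolynomial (ι ⊕ ι) R) :
    eval (kpt (φ ∘ x)) (map φ.toRingHom p) = φ (eval (kpt x) p) := by
  rw [eval_map, ← kpt_comp_eHom]
  exact (eval₂_comp φ.toRingHom (kpt x) p).symm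

omit [Literature.ModelTheory.ExponentialFields.ExponentialRing R] [Literature.ModelTheory.ExponentialFields.ExponentialRing S] in
/-- The exponential partial derivative commutes with mapping coefficients (arbitrary index type;
the case `ι = Fin n` is `Khovanskii.ePD_map` of `KirbyWeakSchanuelAx.lean`). [folklore] -/
theorem ePD_map_of_ringHom (f : R →+* S) {ι : Type*} (j : ι) (p : MvPolynomial (ι ⊕ ι) R) :
    ePD j (map f p) = map f (ePD j p) := by
  simp only [ePD, pderiv_map, map_add, map_mul, map_X]

/-- The Jacobian of the mapped system at the mapped point is the image of the Jacobian.
[folklore] -/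
theorem kjac_map (φ : Literature.ModelTheory.ExponentialFields.ExponentialRingHom R S) {ι : Type*} (x : ι → R)
    (f : ι → MvPolynomial (ι ⊕ ι) R) :
    kjac (φ ∘ x) (fun i => map φ.toRingHom (f i)) = (kjac x f).map φ.toRingHom := by
  ext i j
  simp only [kjac, Matrix.of_apply, Matrix.map_apply, ePD_map_of_ringHom, eval_kpt_map,
    Literature.ModelTheory.ExponentialFields.ExponentialRingHom.coe_toRingHom]

/-- **Transport of Khovanskii solutions along an E-field embedding**: if `x̄` solves the system
`f̄` over `C` in `R`, then `φ x̄` solves `φ f̄` over `φ(C)` in `S` (coefficients, equations and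
the non-vanishing of the Jacobian are preserved by an injective E-ring morphism).
[cite: Kirby2010, Def. 3.1–3.2] -/
theorem IsSol.map (φ : Literature.ModelTheory.ExponentialFields.ExponentialRingHom R S) {C : Set R} {ι : Type*} [Fintype ι]
    [DecidableEq ι] {x : ι → R} {f : ι → MvPolynomial (ι ⊕ ι) R} (h : IsSol C x f) :
    IsSol (φ '' C) (φ ∘ x) (fun i => map φ.toRingHom (f i)) where
  coeff i := by
    rw [mem_polyOver_iff]
    intro m
    rw [coeff_map]
    have hc : (f i).coeff m ∈ Subring.closure C := mem_polyOver_iff.mp (h.coeff i) m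
    have : φ.toRingHom ((f i).coeff m) ∈ (Subring.closure C).map φ.toRingHom :=
      Subring.mem_map.mpr ⟨_, hc, rfl⟩
    rwa [RingHom.map_closure] at this
  eval_eq i := by rw [eval_kpt_map, h.eval_eq, map_zero]
  det_ne := by
    rw [kjac_map, ← RingHom.mapMatrix_apply, ← RingHom.map_det]
    exact (map_ne_zero_iff _ φ.toRingHom.injective).mpr h.det_ne

/-- An E-field embedding maps `ecl C` into `ecl (φ C)`. [cite: Kirby2010, Def. 3.2] -/
theorem image_ecl_subset (φ : Literature.ModelTheory.ExponentialFields.ExponentialRingHom R S) (C : Set R) :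
    φ '' ecl C ⊆ ecl (φ '' C) := by
  classical
  rintro _ ⟨a, ha, rfl⟩
  obtain ⟨ι, _, _, x, f, hx, i, rfl⟩ := mem_ecl_iff.mp ha
  exact mem_ecl_iff.mpr ⟨ι, inferInstance, inferInstance, φ ∘ x, _, hx.map φ, i, rfl⟩

/-- An isomorphism of exponential fields maps `ecl C` onto `ecl (e C)`: `ecl` is an invariant
of the E-field structure. [cite: Kirby2010, Def. 3.2] -/
theorem image_ecl_equiv (e : ExponentialRingEquiv R S) (C : Set R) :
    e '' ecl C = ecl (e '' C) := by
  refine Subset.antisymm ?_ ?_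
  · simpa using image_ecl_subset e.toExponentialRingHom C
  · intro b hb
    have h1 : e.symm '' ecl (e '' C) ⊆ ecl (e.symm '' (e '' C)) := by
      simpa using image_ecl_subset e.symm.toExponentialRingHom (e '' C)
    have h2 : e.symm '' (e '' C) = C := by
      rw [Set.image_image]; simp
    rw [h2] at h1
    exact ⟨e.symm b, h1 ⟨b, hb, rfl⟩, e.apply_symm_apply b⟩

end Functorial

/-! ### `ecl`-closed E-subfields as exponential fields -/

section Subfield

variable {K : Type*} [Field K] [Literature.ModelTheory.ExponentialFields.ExponentialRing K]

/-- The E-subfield `ecl C ≤ K` is an exponential ring for the restricted exponential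
(Kirby 2010, Lemma 3.3: `ecl C` is an E-subfield). [cite: Kirby2010, Lemma 3.3] -/
instance eclSubfield.instExponentialRing (C : Set K) : Literature.ModelTheory.ExponentialFields.ExponentialRing (eclSubfield C) where
  exp a := ⟨Literature.ModelTheory.ExponentialFields.ExponentialRing.exp (a : K), exp_mem_ecl a.2⟩
  exp_zero := Subtype.ext (by simp)
  exp_add a b := Subtype.ext (Literature.ModelTheory.ExponentialFields.ExponentialRing.exp_add (a : K) b)

/-- The restricted exponential, on coordinates. [folklore] -/
@[simp] theorem eclSubfield.coe_exp (C : Set K) (a : eclSubfield C) :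
    ((Literature.ModelTheory.ExponentialFields.ExponentialRing.exp a : eclSubfield C) : K) = Literature.ModelTheory.ExponentialFields.ExponentialRing.exp (a : K) := rfl

/-- The inclusion of the E-subfield `ecl C` into `K` as an E-ring morphism. [folklore] -/
def eclSubfield.eHom (C : Set K) : Literature.ModelTheory.ExponentialFields.ExponentialRingHom (eclSubfield C) K where
  toRingHom := (eclSubfield C).subtype
  map_exp' _ := rfl

/-- The inclusion E-ring morphism is the coercion. [folklore] -/
@[simp] theorem eclSubfield.eHom_apply (C : Set K) (a : eclSubfield C) :
    eclSubfield.eHom C a = (a : K) := rfl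

/-- **`ecl` computed inside an `ecl`-closed E-subfield agrees with `ecl` in `K`**: for
`T ⊆ ecl C`, the exponential-algebraic closure of `T` in the E-field `ecl C` is `ecl T`
(every Khovanskii solution over `T` in `K` has its coordinates in `ecl T ⊆ ecl C`, and
coefficients in `ℤ[T] ⊆ ecl C`). Compare Kirby 2010 (quasiminimal excellent classes),
Lemma 1.3: `cl_H(X) = cl_{H'}(X)` for `H` closed in `H'`. [cite: Kirby2010QMEC, Lemma 1.3] -/
theorem eclSubfield.image_ecl (C : Set K) (T : Set (eclSubfield C)) :
    ((↑) : eclSubfield C → K) '' ecl T = ecl (((↑) : eclSubfield C → K) '' T) := by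
  classical
  refine Subset.antisymm (image_ecl_subset (eclSubfield.eHom C) T) ?_
  intro a ha
  have hT'F : ((↑) : eclSubfield C → K) '' T ⊆ ecl C := by
    rintro _ ⟨t, -, rfl⟩; exact t.2
  -- a Khovanskii solution over `T` in `K`
  obtain ⟨ι, _, _, x, f, hx, i₀, rfl⟩ := mem_ecl_iff.mp ha
  -- its coordinates lie in `ecl T ⊆ ecl (ecl C) = ecl C`
  have hxF : ∀ i, x i ∈ ecl C := by
    intro i
    have : x i ∈ ecl (((↑) : eclSubfield C → K) '' T) :=
      mem_ecl_iff.mpr ⟨ι, inferInstance, inferInstance, x, f, hx, i, rfl⟩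
    have h' := ecl_mono (K := K) hT'F
    rw [ecl_ecl] at h'
    exact h' this
  let x₀ : ι → eclSubfield C := fun i => ⟨x i, hxF i⟩
  have hxx₀ : x = (eclSubfield.eHom C) ∘ x₀ := funext fun i => rfl
  -- its coefficients lie in `ℤ[T] ⊆ ecl C`
  have hcl : Subring.closure (((↑) : eclSubfield C → K) '' T) ≤ (eclSubfield C).toSubring :=
    Subring.closure_le.mpr hT'F
  have hlift : ∀ i, ∃ q : MvPolynomial (ι ⊕ ι) (eclSubfield C),
      map (eclSubfield.eHom C).toRingHom q = f i := by
    intro i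
    show f i ∈ Set.range (map (eclSubfield.eHom C).toRingHom)
    rw [mem_range_map_iff_coeffs_subset]
    intro c hc
    obtain ⟨m, -, rfl⟩ := mem_coeffs_iff.mp hc
    exact ⟨⟨_, hcl (mem_polyOver_iff.mp (hx.coeff i) m)⟩, rfl⟩
  choose f₀ hf₀ using hlift
  have hff₀ : f = fun i => map (eclSubfield.eHom C).toRingHom (f₀ i) :=
    funext fun i => (hf₀ i).symm
  have hinj : Function.Injective (eclSubfield.eHom C).toRingHom :=
    (eclSubfield.eHom C).toRingHom.injective
  -- it is a Khovanskii solution over `T` in the E-field `ecl C`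
  have hsol : IsSol T x₀ f₀ := by
    refine ⟨fun i => ?_, fun i => ?_, ?_⟩
    · rw [mem_polyOver_iff]
      intro m
      have hm : (eclSubfield.eHom C).toRingHom ((f₀ i).coeff m) ∈
          Subring.closure (((↑) : eclSubfield C → K) '' T) := by
        have := mem_polyOver_iff.mp (hx.coeff i) m
        rwa [← hf₀ i, coeff_map] at this
      have hm' : (eclSubfield.eHom C).toRingHom ((f₀ i).coeff m) ∈
          (Subring.closure T).map (eclSubfield.eHom C).toRingHom := by
        rwa [RingHom.map_closure]
      obtain ⟨c, hc, hcm⟩ := Subring.mem_map.mp hm'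
      rwa [← hinj hcm]
    · have h1 := hx.eval_eq i
      rw [hxx₀, hff₀] at h1
      dsimp only at h1
      rw [eval_kpt_map] at h1
      exact (map_eq_zero_iff _ hinj).mp h1
    · have h1 := hx.det_ne
      rw [hxx₀, hff₀, kjac_map, ← RingHom.mapMatrix_apply, ← RingHom.map_det] at h1
      exact (map_ne_zero_iff _ hinj).mp h1
  exact ⟨x₀ i₀, mem_ecl_iff.mpr ⟨ι, inferInstance, inferInstance, x₀, f₀, hsol, i₀, rfl⟩, rfl⟩

end Subfield

end Khovanskii

/-! ### Isomorphisms between `ecl`-closed E-subfields, as maps `K → K` -/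

section EIso

variable {K : Type*} [Field K] [Literature.ModelTheory.ExponentialFields.ExponentialRing K]

/-- `IsEIsoOn g A B`: the map `g : K → K` restricts to an **isomorphism of exponential fields
from `A` onto `B`** — a bijection `A → B` preserving `+`, `·` and `exp` on `A`. Used for
`A = ecl S`, `B = ecl S'` (E-subfields of `K`, Kirby 2010 Lemma 3.3), where these are exactly
the E-field isomorphisms `ecl S ≅ ecl S'`; presenting them as maps `K → K` between subsets (as
the matching maps `f : M → M` of `PregeometryStructures.lean`) avoids dependent types in the
back-and-forth. These are the "isomorphisms between closed subsets" of Kirby 2010 (quasiminimal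
excellent classes), axiom II and Thm 2.1. [cite: Kirby2010QMEC, Def. 1.1 (axiom II) and Thm 2.1] -/
structure IsEIsoOn (g : K → K) (A B : Set K) : Prop where
  /-- `g` is a bijection from `A` onto `B`. -/
  bijOn : Set.BijOn g A B
  /-- `g` is additive on `A`. -/
  map_add : ∀ ⦃u v : K⦄, u ∈ A → v ∈ A → g (u + v) = g u + g v
  /-- `g` is multiplicative on `A`. -/
  map_mul : ∀ ⦃u v : K⦄, u ∈ A → v ∈ A → g (u * v) = g u * g v
  /-- `g` commutes with `exp` on `A`. -/
  map_exp : ∀ ⦃u : K⦄, u ∈ A → g (Literature.ModelTheory.ExponentialFields.ExponentialRing.exp u) = Literature.ModelTheory.ExponentialFields.ExponentialRing.exp (g u)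

namespace IsEIsoOn

/-- The identity is an E-isomorphism of any subset onto itself. [folklore] -/
protected theorem id (A : Set K) : IsEIsoOn _root_.id A A :=
  ⟨Set.bijOn_id A, fun _ _ _ _ => rfl, fun _ _ _ _ => rfl, fun _ _ => rfl⟩

variable {g : K → K} {S S' : Set K}

/-- An E-isomorphism `ecl S ≅ ecl S'` maps `0` to `0`. [folklore] -/
theorem map_zero (h : IsEIsoOn g (ecl S) (ecl S')) : g 0 = 0 := by
  have h0 := h.map_add (Khovanskii.zero_mem_ecl S) (Khovanskii.zero_mem_ecl S)
  rw [add_zero] at h0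
  -- `g 0 = g 0 + g 0`
  have : g 0 + g 0 = g 0 + 0 := by rw [add_zero]; exact h0.symm
  exact add_left_cancel this

/-- An E-isomorphism `ecl S ≅ ecl S'` maps `1` to `1`. [folklore] -/
theorem map_one (h : IsEIsoOn g (ecl S) (ecl S')) : g 1 = 1 := by
  have h1 := h.map_mul (Khovanskii.one_mem_ecl S) (Khovanskii.one_mem_ecl S)
  rw [mul_one] at h1
  rcases mul_eq_left₀_aux (g 1) h1.symm with h01 | h11
  · exfalso
    have : (1 : K) = 0 := h.bijOn.injOn (Khovanskii.one_mem_ecl S) (Khovanskii.zero_mem_ecl S)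
      (h01.trans h.map_zero.symm)
    exact one_ne_zero this
  · exact h11
where
  /-- `a * a = a` in a field forces `a = 0 ∨ a = 1`. -/
  mul_eq_left₀_aux (a : K) (ha : a * a = a) : a = 0 ∨ a = 1 := by
    by_cases h0 : a = 0
    · exact Or.inl h0
    · exact Or.inr (mul_left_cancel₀ h0 (ha.trans (mul_one a).symm))

/-- An E-isomorphism `ecl S ≅ ecl S'` is compatible with negation. [folklore] -/
theorem map_neg (h : IsEIsoOn g (ecl S) (ecl S')) {u : K} (hu : u ∈ ecl S) : g (-u) = -g u := by
  have := h.map_add hu (Khovanskii.neg_mem_ecl hu)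
  rw [add_neg_cancel, h.map_zero] at this
  exact (neg_eq_of_add_eq_zero_right this.symm).symm

/-- The bundled form: an E-isomorphism `ecl S ≅ ecl S'` as an `ExponentialRingEquiv` between
the E-subfields `eclSubfield S` and `eclSubfield S'`. [folklore] -/
def equiv (h : IsEIsoOn g (ecl S) (ecl S')) :
    ExponentialRingEquiv (Khovanskii.eclSubfield S) (Khovanskii.eclSubfield S') where
  toFun a := ⟨g a, h.bijOn.mapsTo a.2⟩
  invFun b := ⟨Function.invFunOn g (ecl S) b, h.bijOn.surjOn.mapsTo_invFunOn b.2⟩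
  left_inv a := Subtype.ext (h.bijOn.invOn_invFunOn.1 a.2)
  right_inv b := Subtype.ext (h.bijOn.invOn_invFunOn.2 b.2)
  map_mul' a b := Subtype.ext (h.map_mul a.2 b.2)
  map_add' a b := Subtype.ext (h.map_add a.2 b.2)
  map_exp' a := Subtype.ext (h.map_exp a.2)

/-- The bundled isomorphism is `g` on coordinates. [folklore] -/
@[simp] theorem coe_equiv_apply (h : IsEIsoOn g (ecl S) (ecl S')) (a : Khovanskii.eclSubfield S) :
    (h.equiv a : K) = g a := rfl

/-- Subsets of `ecl S` are images of subsets of the subtype. [folklore] -/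
theorem image_preimage_coe_of_subset {T : Set K} (hT : T ⊆ ecl S) :
    ((↑) : Khovanskii.eclSubfield S → K) '' (((↑) : Khovanskii.eclSubfield S → K) ⁻¹' T) = T := by
  ext t
  constructor
  · rintro ⟨a, ha, rfl⟩; exact ha
  · intro ht; exact ⟨⟨t, hT ht⟩, ht, rfl⟩

/-- **An E-isomorphism `g : ecl S ≅ ecl S'` carries `ecl T` onto `ecl (g T)` for every
`T ⊆ ecl S`**: closures are invariants of the E-field structure (`Khovanskii.image_ecl_equiv`)
and may be computed inside the `ecl`-closed E-subfields (`Khovanskii.eclSubfield.image_ecl`).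
This is the "closed partial embedding" property of Kirby 2010 (quasiminimal excellent classes),
Def. 1.2 and Lemma 1.3, for Zilber's exponential fields. [cite: Kirby2010QMEC, Lemma 1.3] -/
theorem image_ecl (h : IsEIsoOn g (ecl S) (ecl S')) {T : Set K} (hT : T ⊆ ecl S) :
    g '' ecl T = ecl (g '' T) := by
  set T₀ : Set (Khovanskii.eclSubfield S) := ((↑) : Khovanskii.eclSubfield S → K) ⁻¹' T with hT₀
  have hTT₀ : ((↑) : Khovanskii.eclSubfield S → K) '' T₀ = T := image_preimage_coe_of_subset hT
  have hcomp : g ∘ ((↑) : Khovanskii.eclSubfield S → K) =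
      ((↑) : Khovanskii.eclSubfield S' → K) ∘ h.equiv := funext fun a => rfl
  calc g '' ecl T = g '' (((↑) : Khovanskii.eclSubfield S → K) '' ecl T₀) := by
          rw [Khovanskii.eclSubfield.image_ecl S T₀, hTT₀]
    _ = ((↑) : Khovanskii.eclSubfield S' → K) '' (h.equiv '' ecl T₀) := by
          rw [Set.image_image, Set.image_image]; rfl
    _ = ((↑) : Khovanskii.eclSubfield S' → K) '' ecl (h.equiv '' T₀) := by
          rw [Khovanskii.image_ecl_equiv]
    _ = ecl (((↑) : Khovanskii.eclSubfield S' → K) '' (h.equiv '' T₀)) :=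
          Khovanskii.eclSubfield.image_ecl S' _
    _ = ecl (g '' T) := by
          rw [Set.image_image, ← hTT₀, Set.image_image]; rfl

/-- The inverse of an E-isomorphism `ecl S ≅ ecl S'` (as the map `Function.invFunOn g (ecl S)`)
is an E-isomorphism `ecl S' ≅ ecl S`. [folklore] -/
protected theorem symm (h : IsEIsoOn g (ecl S) (ecl S')) :
    IsEIsoOn (Function.invFunOn g (ecl S)) (ecl S') (ecl S) := by
  have hinv := h.bijOn.invOn_invFunOn
  refine ⟨hinv.symm.bijOn h.bijOn.surjOn.mapsTo_invFunOn h.bijOn.mapsTo, ?_, ?_, ?_⟩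
  · intro u v hu hv
    obtain ⟨a, ha, rfl⟩ := h.bijOn.surjOn hu
    obtain ⟨b, hb, rfl⟩ := h.bijOn.surjOn hv
    rw [← h.map_add ha hb, hinv.1 ha, hinv.1 hb, hinv.1 (Khovanskii.add_mem_ecl ha hb)]
  · intro u v hu hv
    obtain ⟨a, ha, rfl⟩ := h.bijOn.surjOn hu
    obtain ⟨b, hb, rfl⟩ := h.bijOn.surjOn hv
    rw [← h.map_mul ha hb, hinv.1 ha, hinv.1 hb, hinv.1 (Khovanskii.mul_mem_ecl ha hb)]
  · intro u hu
    obtain ⟨a, ha, rfl⟩ := h.bijOn.surjOn hu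
    rw [← h.map_exp ha, hinv.1 ha, hinv.1 (Khovanskii.exp_mem_ecl ha)]

/-- The inverse E-isomorphism inverts `g` on `ecl S`. [folklore] -/
theorem symm_apply_apply (h : IsEIsoOn g (ecl S) (ecl S')) {u : K} (hu : u ∈ ecl S) :
    Function.invFunOn g (ecl S) (g u) = u :=
  h.bijOn.invOn_invFunOn.1 hu

/-- Restriction of an E-isomorphism `ecl S ≅ ecl S'` to the closure of a subset `T ⊆ ecl S`:
an E-isomorphism `ecl T ≅ ecl (g T)`. [folklore] -/
theorem restrict (h : IsEIsoOn g (ecl S) (ecl S')) {T : Set K} (hT : T ⊆ ecl S) :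
    IsEIsoOn g (ecl T) (ecl (g '' T)) := by
  have hsub : ecl T ⊆ ecl S := by
    have := ecl_mono (K := K) hT
    rwa [Khovanskii.ecl_ecl] at this
  refine ⟨?_, fun u v hu hv => h.map_add (hsub hu) (hsub hv),
    fun u v hu hv => h.map_mul (hsub hu) (hsub hv), fun u hu => h.map_exp (hsub hu)⟩
  rw [← h.image_ecl hT]
  exact h.bijOn.subset_left hsub

end IsEIsoOn

/-- Adjoining an element of `ecl S` does not change the closure. [cite: Kirby2010, Lemma 3.3] -/
theorem ecl_insert_of_mem {S : Set K} {a : K} (ha : a ∈ ecl S) : ecl (insert a S) = ecl S := by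
  refine Subset.antisymm ?_ (ecl_mono (Set.subset_insert a S))
  have : ecl (insert a S) ⊆ ecl (ecl S) := ecl_mono (Set.insert_subset ha (subset_ecl S))
  rwa [Khovanskii.ecl_ecl] at this

/-! ### The back-and-forth system of a Zilber field -/

variable (K) in
/-- **The system of local isomorphisms of an exponential field**: the `n`-tuples `x` and `y`
*correspond* if some E-field isomorphism `ecl(x) ≅ ecl(y)` between the exponential-algebraic
closures maps `x` to `y`. For a Zilber field this is the back-and-forth system of Zilber 2005 §5
/ Kirby 2010 (quasiminimal excellent classes) Thm 2.1: isomorphisms between countable closed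
subsets, extended one generic or one closure-element at a time. [cite: Kirby2010QMEC, Thm 2.1] -/
def EclIsoRel (n : ℕ) (x y : Fin n → K) : Prop :=
  ∃ g : K → K, IsEIsoOn g (ecl (Set.range x)) (ecl (Set.range y)) ∧ ∀ i, g (x i) = y i

namespace EclIsoRel

/-- Symmetry: invert the isomorphism. [folklore] -/
protected theorem symm {n : ℕ} {x y : Fin n → K} (hxy : EclIsoRel K n x y) : EclIsoRel K n y x := by
  obtain ⟨g, h, hg⟩ := hxy
  refine ⟨Function.invFunOn g (ecl (Set.range x)), h.symm, fun i => ?_⟩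
  rw [← hg i]
  exact h.symm_apply_apply (subset_ecl _ ⟨i, rfl⟩)

/-- Sub-tuples correspond, by restriction of the isomorphism to the closure of the sub-tuple.
[folklore] -/
theorem comp {n : ℕ} {x y : Fin n → K} (hxy : EclIsoRel K n x y) {m : ℕ} (ι : Fin m → Fin n) :
    EclIsoRel K m (x ∘ ι) (y ∘ ι) := by
  obtain ⟨g, h, hg⟩ := hxy
  have hT : Set.range (x ∘ ι) ⊆ ecl (Set.range x) :=
    (Set.range_comp_subset_range ι x).trans (subset_ecl _)
  have himg : g '' Set.range (x ∘ ι) = Set.range (y ∘ ι) := by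
    rw [← Set.range_comp]
    congr 1
    funext i
    exact hg (ι i)
  refine ⟨g, ?_, fun i => hg (ι i)⟩
  rw [← himg]
  exact h.restrict hT

/-- Corresponding tuples have the same pattern of equalities. [folklore] -/
theorem apply_eq {n : ℕ} {x y : Fin n → K} (hxy : EclIsoRel K n x y) {i j : Fin n}
    (hij : x i = x j) : y i = y j := by
  obtain ⟨g, -, hg⟩ := hxy
  rw [← hg i, ← hg j, hij]

/-- Corresponding tuples satisfy the same unnested equations `xᵢ = xⱼ + xₗ`, `xᵢ = xⱼ · xₗ`,
`xᵢ = -xⱼ`, `xᵢ = 0`, `xᵢ = 1`, `xᵢ = exp xⱼ` (the isomorphism is defined on `ecl(x) ⊇ x`).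
[folklore] -/
theorem funMap_eq {n : ℕ} {x y : Fin n → K} (hxy : EclIsoRel K n x y) {k : ℕ}
    (f : Literature.ModelTheory.ExponentialFields.Language.expRing.Functions k) (ι : Fin k → Fin n) (i : Fin n)
    (hi : x i = Language.Structure.funMap f (x ∘ ι)) :
    y i = Language.Structure.funMap f (y ∘ ι) := by
  obtain ⟨g, h, hg⟩ := hxy
  have hx : ∀ j, x j ∈ ecl (Set.range x) := fun j => subset_ecl _ ⟨j, rfl⟩
  cases f with
  | add =>
    rw [Literature.ModelTheory.ExponentialFields.Language.expRing.funMap_add] at hi ⊢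
    simp only [Function.comp_apply] at hi ⊢
    rw [← hg, ← hg, ← hg, hi, h.map_add (hx _) (hx _)]
  | mul =>
    rw [Literature.ModelTheory.ExponentialFields.Language.expRing.funMap_mul] at hi ⊢
    simp only [Function.comp_apply] at hi ⊢
    rw [← hg, ← hg, ← hg, hi, h.map_mul (hx _) (hx _)]
  | neg =>
    rw [Literature.ModelTheory.ExponentialFields.Language.expRing.funMap_neg] at hi ⊢
    simp only [Function.comp_apply] at hi ⊢
    rw [← hg, ← hg, hi, h.map_neg (hx _)]
  | zero =>
    rw [Literature.ModelTheory.ExponentialFields.Language.expRing.funMap_zero] at hi ⊢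
    rw [← hg, hi, h.map_zero]
  | one =>
    rw [Literature.ModelTheory.ExponentialFields.Language.expRing.funMap_one] at hi ⊢
    rw [← hg, hi, h.map_one]
  | exp =>
    rw [Literature.ModelTheory.ExponentialFields.Language.expRing.funMap_exp] at hi ⊢
    simp only [Function.comp_apply] at hi ⊢
    rw [← hg, ← hg, hi, h.map_exp (hx _)]

/-- The language of exponential rings has no relation symbols. [folklore] -/
theorem relMap {n : ℕ} {x y : Fin n → K} (_hxy : EclIsoRel K n x y) {k : ℕ}
    (R : Literature.ModelTheory.ExponentialFields.Language.expRing.Relations k) (ι : Fin k → Fin n)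
    (_h : Language.Structure.RelMap R (x ∘ ι)) : Language.Structure.RelMap R (y ∘ ι) := by
  cases R

/-- Forth inside the closure: if `a ∈ ecl(x)` the same isomorphism matches `(x, a)` with
`(y, g a)`. [folklore] -/
theorem snoc_of_mem {n : ℕ} {x y : Fin n → K} {g : K → K}
    (h : IsEIsoOn g (ecl (Set.range x)) (ecl (Set.range y))) (hg : ∀ i, g (x i) = y i) {a : K}
    (ha : a ∈ ecl (Set.range x)) :
    EclIsoRel K (n + 1) (Fin.snoc x a) (Fin.snoc y (g a)) := by
  refine ⟨g, ?_, fun i => ?_⟩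
  · rw [Fin.range_snoc, Fin.range_snoc, ecl_insert_of_mem ha, ecl_insert_of_mem (h.bijOn.mapsTo ha)]
    exact h
  · refine Fin.lastCases ?_ (fun j => ?_) i
    · simp
    · simp [hg j]

end EclIsoRel

end EIso

/-! ### The deep input: uniqueness of `ecl`-closures over a generic element -/

/-- NAMED FACT — **extension of isomorphisms of closed sets over a generic element** (Kirby,
*On quasiminimal excellent classes*, J. Symbolic Logic 75 (2010), Thm 2.1, in the class of
Zilber's exponential fields, which satisfies its hypotheses — axioms I and II of quasiminimal
excellent classes — by Zilber 2005 §5 as completed by Bays–Kirby 2013, Props 4 and 5; the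
resulting categoricity and quasiminimality statement is Bays–Kirby 2018, Thm 9.1).
Let `K` be a Zilber field, `b`, `b'` finite tuples, `g` an isomorphism of exponential fields
from `ecl(b)` onto `ecl(b')` (both are countable `ecl`-closed E-subfields, i.e. "countable closed
subsets"), and `a ∉ ecl(b)`, `a' ∉ ecl(b')`. Then `g ∪ {(a, a')}` extends to an isomorphism of
exponential fields from `ecl(b, a)` onto `ecl(b', a')`. (Kirby's Thm 2.1 with `G = ecl(b)`,
`H = ecl(G ∪ {a})`, basis `B = {a}` of `H` over `G`, `f₀ = g`, `ψ_B = {(a, a')}`: the image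
`ecl(b') ∪ {a'}` spans `H' = ecl(b', a')`, so `ψ̂` is an isomorphism.) This is the whole
model-theoretic core of Zilber's categoricity theorem below `ℵ₁`; its proof in print goes through
`ℵ₀`-homogeneity over countable closed subsets (strong exponential-algebraic closedness as
`ℵ₀`-saturation for finitely generated exponentially-algebraic strong extensions, Bays–Kirby 2018
Lemma 8.3, and Kummer genericity / the thumbtack lemma, Bays–Kirby 2013 Prop. 2 and Prop. 5).
Users take `(h : IsZilberField.eclIso_extension)`.
[cite: Kirby2010QMEC, Thm 2.1] [cite: BaysKirby2013Excellence, Prop. 4 and Prop. 5]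
[cite: BaysKirby2018ANT, Thm 9.1] [cite: Zilber2005PseudoExp, §5 and Thm 1.2] -/
def IsZilberField.eclIso_extension : Prop :=
  ∀ {K : Type*} [Field K] [CharZero K] [Literature.ModelTheory.ExponentialFields.ExponentialRing K] (_ : IsZilberField K)
    {m n : ℕ} (b : Fin m → K) (b' : Fin n → K) (g : K → K),
    IsEIsoOn g (ecl (Set.range b)) (ecl (Set.range b')) →
    ∀ {a a' : K}, a ∉ ecl (Set.range b) → a' ∉ ecl (Set.range b') →
      ∃ g' : K → K, IsEIsoOn g' (ecl (insert a (Set.range b))) (ecl (insert a' (Set.range b'))) ∧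
        Set.EqOn g' g (ecl (Set.range b)) ∧ g' a = a'

/-! ### Assembly: Zilber fields are quasiminimal, granted the named fact -/

section Assembly

universe u

variable {K : Type u} [Field K] [CharZero K] [Literature.ModelTheory.ExponentialFields.ExponentialRing K]

omit [CharZero K] in
/-- In an uncountable exponential field with the countable closure property there are elements
outside the closure of any finite tuple. [cite: BHHKK2014, Lemma 2.2 (proof)] -/
theorem exists_notMem_ecl_range [Uncountable K] (hccp : HasCountableClosureProperty K) {n : ℕ}
    (y : Fin n → K) : ∃ b : K, b ∉ ecl (Set.range y) := by
  by_contra! hcon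
  have : (Set.univ : Set K).Countable :=
    (hccp _ (Set.countable_range y)).mono fun z _ => hcon z
  exact Set.not_countable_univ this

/-- **The isomorphisms between closures of finite sets of an uncountable Zilber field form a
back-and-forth system of local isomorphisms**, granted `IsZilberField.eclIso_extension`: forth
over an element of the closure is restriction (`EclIsoRel.snoc_of_mem`); forth over a generic
element uses a generic element on the other side (countable closure property, `K` uncountable)
and the named fact. (Kirby 2010, proof of Thm 2.1; Zilber 2005 §5.)
[cite: Kirby2010QMEC, Thm 2.1 (proof)] -/
theorem isLocalIsoSystem_eclIsoRel [Uncountable K] (hZ : IsZilberField.eclIso_extension.{u})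
    (hK : IsZilberField K) : Literature.ModelTheory.ExponentialFields.Language.expRing.IsLocalIsoSystem (EclIsoRel K) where
  symm hxy := hxy.symm
  comp hxy _ ι := hxy.comp ι
  apply_eq hxy _ _ hij := hxy.apply_eq hij
  funMap_eq hxy _ f ι i hi := hxy.funMap_eq f ι i hi
  relMap hxy _ R ι hR := hxy.relMap R ι hR
  forth := by
    rintro n x y ⟨g, h, hg⟩ a
    by_cases ha : a ∈ ecl (Set.range x)
    · exact ⟨g a, EclIsoRel.snoc_of_mem h hg ha⟩
    · obtain ⟨b, hb⟩ := exists_notMem_ecl_range hK.hasCountableClosureProperty y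
      obtain ⟨g', h', hEq, hga⟩ := hZ hK x y g h ha hb
      refine ⟨b, g', ?_, fun i => ?_⟩
      · rw [Fin.range_snoc, Fin.range_snoc]
        exact h'
      · refine Fin.lastCases ?_ (fun j => ?_) i
        · simpa using hga
        · simp only [Fin.snoc_castSucc]
          rw [hEq (subset_ecl _ ⟨j, rfl⟩), hg j]

/-- **Uniqueness of the generic type over a finite tuple**, granted
`IsZilberField.eclIso_extension`: any two elements outside `ecl(b)` correspond over `b` (extend
the identity of `ecl(b)`). (Kirby 2010, Lemma 5.1, first part; Bays–Kirby 2013, Prop. 5 (i).)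
[cite: Kirby2010QMEC, Lemma 5.1] [cite: BaysKirby2013Excellence, Prop. 5] -/
theorem eclIsoRel_snoc_of_notMem (hZ : IsZilberField.eclIso_extension.{u}) (hK : IsZilberField K)
    {k : ℕ} (b : Fin k → K) {a c : K} (ha : a ∉ ecl (Set.range b)) (hc : c ∉ ecl (Set.range b)) :
    EclIsoRel K (k + 1) (Fin.snoc b a) (Fin.snoc b c) := by
  obtain ⟨g', h', hEq, hga⟩ := hZ hK b b id (IsEIsoOn.id _) ha hc
  refine ⟨g', ?_, fun i => ?_⟩
  · rw [Fin.range_snoc, Fin.range_snoc]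
    exact h'
  · refine Fin.lastCases ?_ (fun j => ?_) i
    · simpa using hga
    · simp only [Fin.snoc_castSucc]
      exact hEq (subset_ecl _ ⟨j, rfl⟩)

/-- **Zilber fields are quasiminimal, granted `IsZilberField.eclIso_extension`** (Zilber 2005,
Thm 1.2; Bays–Kirby 2018, Thm 9.1; the argument is Kirby 2010, Lemma 5.1 with back-and-forth in
place of automorphisms, Bays–Hart–Hyttinen–Kesälä–Kirby 2014, Prop. 7.1): a countable structure
is trivially quasiminimal; an uncountable Zilber field carries the back-and-forth system
`EclIsoRel K` (`isLocalIsoSystem_eclIsoRel`) under which, for every finite tuple `b`, all points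
outside the countable set `ecl(b)` are conjugate over `b` (`eclIsoRel_snoc_of_notMem`), so
`IsLocalIsoSystem.countable_or_countable_compl` applies.
[cite: Zilber2005PseudoExp, Thm 1.2] [cite: BaysKirby2018ANT, Thm 9.1]
[cite: Kirby2010QMEC, Lemma 5.1] -/
theorem IsZilberField.isQuasiminimal_of_eclIso_extension' (hZ : IsZilberField.eclIso_extension.{u})
    (hK : IsZilberField K) : Literature.ModelTheory.ExponentialFields.Language.expRing.IsQuasiminimal K := by
  intro s hs
  by_cases hc : Countable K
  · exact Or.inl s.to_countable
  · haveI : Uncountable K := ⟨hc⟩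
    exact (isLocalIsoSystem_eclIsoRel hZ hK).countable_or_countable_compl
      (fun b => ⟨ecl (Set.range b), hK.hasCountableClosureProperty _ (Set.countable_range b),
        fun _ _ ha hc => eclIsoRel_snoc_of_notMem hZ hK b ha hc⟩) hs

/-- **Reduction of the named fact `IsZilberField.isQuasiminimal` (Zilber 2005, Thm 1.2) to
`IsZilberField.eclIso_extension`** (Kirby 2010, Thm 2.1 for Zilber fields): every Zilber field is
quasiminimal in the language of exponential rings, granted the extension of isomorphisms of
closures over generic elements. [cite: Zilber2005PseudoExp, Thm 1.2] [cite: Kirby2010QMEC, Thm 2.1] -/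
theorem IsZilberField.isQuasiminimal_of_eclIso_extension (hZ : IsZilberField.eclIso_extension.{u}) :
    IsZilberField.isQuasiminimal.{u} := by
  intro K _ _ _ hK
  exact hK.isQuasiminimal_of_eclIso_extension' hZ

end Assembly

end Literature.NumberTheory.Transcendental
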